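import Summits.QuantumFields.YangMills.Theorems.UnitScaleTiltProp7CovariantCoercivity
import HarnessLib

/-!
# Route `UnitScaleTilt`, crux K1 «MinimiserStabilityRegPr» (stmt-QuantumFields-19200), route-R E′ S3 K-form engine (DESIGN-S3-KFORM-ENGINE-g15 row R3′) — (T-F):
# THE COVARIANT LINE ∕ FACE TRACE LETTERS — two points of one straight line differ, after transport, by the line's covariant variation; the covariant
# straight-line block sum minus `ℓ`× the transported face value is bounded by the LONGITUDINAL covariant gradient (junk-free); the 1-D trace inequality

Cell `ym3-torus`, width seat `ym3-torus-px17` (gen 2; LOCATE-R3PRIME-COVFACEFLUX-px17g2.md §0.1 (E)(F), §0.7 (T-F)).  THEOREMS ONLY (0 `def`, 0 `sorry`);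
`--supports stmt-QuantumFields-19200`, count-neutral.  YM₃ on T³ is a ladder rung (R3), not the Clay problem; nothing here claims a stub, the crux, d = 4 or the mass gap.

WHY.  The flat real core of the ζ-row engine (✓ `Prop7CentreHarmonicDivEngine.sum_coarseDiff_sq_le`) compares the straight-line block mean of a bond field with its
far-face mean (✓ `Prop7FaceFluxLineMean.sq_lineMean_sub_faceMean_le`: each line crosses the face once, telescoping, Cauchy–Schwarz).  Its covariant twin (row R3′)
uses the engine's covariant straight-line block functional `A^V` (✓ `Prop7CovariantCoercivity.sum_normSq_le_covLineAvg_add_covGrad_dir`: comb transport to the block corner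
after the straight transport `V([x, x + te_μ])`).  THIS FILE is the transport-exact part of that twin: along ONE line the comb prefix `g` is a fixed bi-contractive unit and
the straight transports satisfy `V([x, x+(s+1)e_μ]) = V([x, x+se_μ])·V(x+se_μ, x+(s+1)e_μ)` (✓ `holT_replicate_succ`), so every comparison of two transported values on the
line is a telescoping sum of transported FORWARD COVARIANT DERIVATIVES `(∇^V_μ f)(z) = R(V(z,z+e_μ))f(z+e_μ) − f(z)` (✓ `conjR_holT_replicate_sub_eq_sum`), and conjugation by
a bi-contractive unit does not increase norms (✓ `B8Ineq132.norm_conjR`).  No plaquette variable, no smallness and no divergence condition enter: the junk of R3′ is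
born only at the faces' Gauss law (file (T-G)), not here.

WHAT IS PROVED (ns `…Theorems.Prop7CovLineFaceTrace`; `V` a `U1`-valued background on `Site P i`, `f` an `M_N(ℂ)`-valued site function, `x_t := x + te_μ`):
* §1 `norm_partialSum_sub_partialSum_le` (normed-group twin of ✓ `abs_partialSum_sub_le`); ★ `norm_conjR_line_sub_conjR_line_le` — for a prefix `g ∈ U1` and `t, t′ ≤ n`:
  `‖R(g·V([x,x_t]))f(x_t) − R(g·V([x,x_{t′}]))f(x_{t′})‖ ≤ Σ_{s<n}‖(∇^V_μ f)(x_s)‖`.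
* §2 ★★ `norm_lineSum_sub_smul_faceValue_le` — `‖Σ_{t<n} R(g·V([x,x_t]))f(x_t) − n·R(g·V([x,x_{t₀}]))f(x_{t₀})‖ ≤ n·Σ_{s<n}‖(∇^V_μ f)(x_s)‖` (`t₀ < n`: the line's own face value);
  ★★ `normSq_blockLineMean_sub_faceMean_le` — summed over the `(L^e)^d` lines of a block (offsets `r`, prefixes `g r ∈ U1`, face index `t₀ r < L^e` free) and squared:
  `‖(Vℓ)⁻¹·Σ_rΣ_{t<ℓ}R(g_r V([x_r, x_{r,t}]))f(x_{r,t}) − V⁻¹·Σ_r R(g_r V([x_r, x_{r,t₀ r}]))f(x_{r,t₀ r})‖² ≤ ℓV⁻¹·Σ_rΣ_{s<ℓ}‖(∇^V_μ f)(x_{r,s})‖²` (`V = (L^e)^d`) — the covariant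
  ✓ `sq_lineMean_sub_faceMean_le` with the flat constant `1`, the face value read PER LINE (its `ℓ` line-mates carry their own transports).
* §3 ★ `normSq_apply_le_line_trace` — the 1-D trace inequality along a covariant line: for `t₀ < n`, `‖f(x_{t₀})‖² ≤ 2n⁻¹·Σ_{s<n}‖f(x_s)‖² + 2n·Σ_{s<n}‖(∇^V_μ f)(x_s)‖²`
  (norms only: transports are invisible) — summed over lines it books every face-supported quantity by `2ℓ⁻¹·mass + 2ℓ·longitudinal gradient energy`.
HONEST SCOPE.  Kinematics at an exact `U1` background; nothing of Bałaban's is asserted; the Gauss law, the reduced-vs-line defects and the R3′ assembly are elsewhere.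

References: T. Bałaban, CMP 95 (1984) 17–40 [Balaban1984PropagatorsI] ((1.18)–(1.21) pp.20–21, Prop. 1.1 (1.90) p.33); CMP 99 (1985) 75–102 [Balaban1985RegularSpaces]
((1.1) p.76); CMP 98 (1985) 17–51 [Balaban1985Averaging] ((9) p.18); CMP 102 (1985) 277–309 [Balaban1985Variational] (Prop. 7 p.299).
-/

set_option autoImplicit false

noncomputable section

open scoped BigOperators Matrix.Norms.L2Operator

namespace Summit.QuantumFields.YangMills.Theorems.Prop7CovLineFaceTrace

open Literature.MathematicalPhysics.QuantumFieldTheory.Balaban1983to89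
open Finset
open B7Prop1Explicit (U1)
open B7Eq78Linearization (conjR conjR_sub conjR_smul_real)
open B8Ineq132 (norm_conjR conjR_conjR conjR_sum)
open B10Eq27TorusAxialLog (holT)
open Summit.QuantumFields.YangMills.Theorems.Prop7CovariantCoercivity (holT_mem conjR_holT_replicate_sub_eq_sum)

variable {P : Params} {i : ℕ} {N : ℕ} [NeZero N]

/-! ## §1 Two points of one covariant line -/

omit [NeZero N] in
/-- Two partial sums of one sequence differ in norm by at most the sum of the norms (normed-group twin of ✓ `Prop7FaceFluxLineMean.abs_partialSum_sub_le`). [folklore] -/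
theorem norm_partialSum_sub_partialSum_le (a : ℕ → Matrix (Fin N) (Fin N) ℂ) {t t' n : ℕ} (ht : t ≤ n) (ht' : t' ≤ n) :
    ‖∑ s ∈ range t, a s - ∑ s ∈ range t', a s‖ ≤ ∑ s ∈ range n, ‖a s‖ := by
  wlog htt : t' ≤ t generalizing t t'
  · rw [norm_sub_rev]; exact this ht' ht (Nat.le_of_not_le htt)
  rw [← Finset.sum_Ico_eq_sub _ htt]
  calc ‖∑ s ∈ Ico t' t, a s‖ ≤ ∑ s ∈ Ico t' t, ‖a s‖ := norm_sum_le _ _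
    _ ≤ ∑ s ∈ range n, ‖a s‖ := by
        refine Finset.sum_le_sum_of_subset_of_nonneg (fun s hs => ?_) (fun _ _ _ => norm_nonneg _)
        rw [mem_Ico] at hs
        exact mem_range.2 (by omega)

/-- ★ **TWO POINTS OF ONE COVARIANT LINE**: for a bi-contractive prefix `g` (the comb transport to the block corner) and `t, t′ ≤ n`,
`‖R(g·V([x, x+te_μ]))f(x+te_μ) − R(g·V([x, x+t′e_μ]))f(x+t′e_μ)‖ ≤ Σ_{s<n} ‖(∇^V_μ f)(x+se_μ)‖` — both values are `R(g)(f(x) + partial sums of transported forward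
covariant derivatives)` (✓ `conjR_holT_replicate_sub_eq_sum`), and `R` of a `U1` unit is an isometry. [cite: Balaban1985RegularSpaces, (1.1) p.76; Balaban1985Averaging, (9) p.18] -/
theorem norm_conjR_line_sub_conjR_line_le {V : GaugeField P i (Matrix (Fin N) (Fin N) ℂ)ˣ} (hV : ∀ b, V b ∈ U1 (Matrix (Fin N) (Fin N) ℂ))
    {g : (Matrix (Fin N) (Fin N) ℂ)ˣ} (hg : g ∈ U1 (Matrix (Fin N) (Fin N) ℂ))
    (f : Site P i → Matrix (Fin N) (Fin N) ℂ) (x : Site P i) (μ : Fin P.d) {t t' n : ℕ} (ht : t ≤ n) (ht' : t' ≤ n) :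
    ‖conjR (g * holT V x (List.replicate t (μ, true))) (f ((fun z : Site P i => z.shift μ)^[t] x))
        - conjR (g * holT V x (List.replicate t' (μ, true))) (f ((fun z : Site P i => z.shift μ)^[t'] x))‖
      ≤ ∑ s ∈ range n, ‖conjR (V ⟨(fun z : Site P i => z.shift μ)^[s] x, μ⟩) (f (((fun z : Site P i => z.shift μ)^[s] x).shift μ))
            - f ((fun z : Site P i => z.shift μ)^[s] x)‖ := by
  -- the transported forward covariant derivatives along the line
  set a : ℕ → Matrix (Fin N) (Fin N) ℂ := fun s => conjR (holT V x (List.replicate s (μ, true)))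
      (conjR (V ⟨(fun z : Site P i => z.shift μ)^[s] x, μ⟩) (f (((fun z : Site P i => z.shift μ)^[s] x).shift μ))
        - f ((fun z : Site P i => z.shift μ)^[s] x)) with ha
  have hpt : ∀ t : ℕ, conjR (holT V x (List.replicate t (μ, true))) (f ((fun z : Site P i => z.shift μ)^[t] x)) = f x + ∑ s ∈ range t, a s := by
    intro t
    rw [← conjR_holT_replicate_sub_eq_sum V f x μ t]
    abel
  rw [← conjR_conjR, ← conjR_conjR, ← conjR_sub, norm_conjR hg, hpt t, hpt t', add_sub_add_left_eq_sub]
  refine (norm_partialSum_sub_partialSum_le a ht ht').trans (le_of_eq (Finset.sum_congr rfl fun s _ => ?_))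
  rw [ha]
  exact norm_conjR (holT_mem hV x _) _

/-! ## §2 The covariant line sum versus the line's own face value -/

/-- ★★ **LINE SUM VERSUS `n`× ONE VALUE OF THE LINE**: for `t₀ < n`,
`‖Σ_{t<n} R(g·V([x,x+te_μ]))f(x+te_μ) − n·R(g·V([x,x+t₀e_μ]))f(x+t₀e_μ)‖ ≤ n·Σ_{s<n}‖(∇^V_μ f)(x+se_μ)‖` (term by term by §1). [cite: Balaban1984PropagatorsI, (1.21) p.21] -/
theorem norm_lineSum_sub_smul_faceValue_le {V : GaugeField P i (Matrix (Fin N) (Fin N) ℂ)ˣ} (hV : ∀ b, V b ∈ U1 (Matrix (Fin N) (Fin N) ℂ))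
    {g : (Matrix (Fin N) (Fin N) ℂ)ˣ} (hg : g ∈ U1 (Matrix (Fin N) (Fin N) ℂ))
    (f : Site P i → Matrix (Fin N) (Fin N) ℂ) (x : Site P i) (μ : Fin P.d) {t₀ n : ℕ} (ht₀ : t₀ < n) :
    ‖∑ t ∈ range n, conjR (g * holT V x (List.replicate t (μ, true))) (f ((fun z : Site P i => z.shift μ)^[t] x))
        - (n : ℝ) • conjR (g * holT V x (List.replicate t₀ (μ, true))) (f ((fun z : Site P i => z.shift μ)^[t₀] x))‖
      ≤ (n : ℝ) * ∑ s ∈ range n, ‖conjR (V ⟨(fun z : Site P i => z.shift μ)^[s] x, μ⟩) (f (((fun z : Site P i => z.shift μ)^[s] x).shift μ))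
            - f ((fun z : Site P i => z.shift μ)^[s] x)‖ := by
  have hsmul : (n : ℝ) • conjR (g * holT V x (List.replicate t₀ (μ, true))) (f ((fun z : Site P i => z.shift μ)^[t₀] x))
      = ∑ _t ∈ range n, conjR (g * holT V x (List.replicate t₀ (μ, true))) (f ((fun z : Site P i => z.shift μ)^[t₀] x)) := by
    rw [Finset.sum_const, card_range, ← Nat.cast_smul_eq_nsmul ℝ]
  rw [hsmul, ← Finset.sum_sub_distrib]
  refine (norm_sum_le _ _).trans ?_
  calc ∑ t ∈ range n, ‖conjR (g * holT V x (List.replicate t (μ, true))) (f ((fun z : Site P i => z.shift μ)^[t] x))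
          - conjR (g * holT V x (List.replicate t₀ (μ, true))) (f ((fun z : Site P i => z.shift μ)^[t₀] x))‖
      ≤ ∑ _t ∈ range n, ∑ s ∈ range n, ‖conjR (V ⟨(fun z : Site P i => z.shift μ)^[s] x, μ⟩) (f (((fun z : Site P i => z.shift μ)^[s] x).shift μ))
            - f ((fun z : Site P i => z.shift μ)^[s] x)‖ :=
        Finset.sum_le_sum fun t ht => norm_conjR_line_sub_conjR_line_le hV hg f x μ (mem_range.1 ht).le ht₀.le
    _ = (n : ℝ) * _ := by rw [Finset.sum_const, card_range, nsmul_eq_mul]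

omit [NeZero N] in
/-- The real-algebra step: `‖T‖ ≤ Σ_r ℓ·G_r`, `#r = V` ⇒ `‖(Vℓ)⁻¹·T‖² ≤ ℓV⁻¹·Σ_r S_r` whenever `G_r² ≤ ℓ·S_r` (Cauchy–Schwarz twice). [folklore] -/
theorem normSq_smul_le_aux {ι : Type*} (s : Finset ι) {Vv ℓ : ℝ} (hV : 0 < Vv) (hℓ : 0 < ℓ) (hcard : (s.card : ℝ) = Vv)
    (T : Matrix (Fin N) (Fin N) ℂ) (G S : ι → ℝ) (hT : ‖T‖ ≤ ∑ r ∈ s, ℓ * G r) (hG : ∀ r ∈ s, G r ^ 2 ≤ ℓ * S r) (hG0 : ∀ r ∈ s, 0 ≤ G r) :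
    ‖(Vv * ℓ)⁻¹ • T‖ ^ 2 ≤ ℓ * Vv⁻¹ * ∑ r ∈ s, S r := by
  have hsumG : (∑ r ∈ s, G r) ^ 2 ≤ Vv * ∑ r ∈ s, G r ^ 2 := by
    have hcs := sq_sum_le_card_mul_sum_sq (s := s) (f := G)
    rwa [hcard] at hcs
  have hGS : ∑ r ∈ s, G r ^ 2 ≤ ℓ * ∑ r ∈ s, S r := by
    rw [Finset.mul_sum]; exact Finset.sum_le_sum hG
  have hT' : ‖T‖ ≤ ℓ * ∑ r ∈ s, G r := by rwa [Finset.mul_sum]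
  have hT0 : 0 ≤ ∑ r ∈ s, G r := Finset.sum_nonneg hG0
  rw [norm_smul, mul_pow, Real.norm_eq_abs, abs_inv, abs_of_pos (mul_pos hV hℓ)]
  have h1 : ‖T‖ ^ 2 ≤ (ℓ * ∑ r ∈ s, G r) ^ 2 := pow_le_pow_left₀ (norm_nonneg _) hT' 2
  calc (Vv * ℓ)⁻¹ ^ 2 * ‖T‖ ^ 2 ≤ (Vv * ℓ)⁻¹ ^ 2 * (ℓ * ∑ r ∈ s, G r) ^ 2 := mul_le_mul_of_nonneg_left h1 (sq_nonneg _)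
    _ = (Vv * ℓ)⁻¹ ^ 2 * ℓ ^ 2 * (∑ r ∈ s, G r) ^ 2 := by ring
    _ ≤ (Vv * ℓ)⁻¹ ^ 2 * ℓ ^ 2 * (Vv * (ℓ * ∑ r ∈ s, S r)) :=
        mul_le_mul_of_nonneg_left (hsumG.trans (mul_le_mul_of_nonneg_left hGS hV.le)) (by positivity)
    _ = ℓ * Vv⁻¹ * ∑ r ∈ s, S r := by field_simp

/-- ★★ **THE COVARIANT STRAIGHT-LINE BLOCK MEAN VERSUS THE TRANSPORTED FACE VALUES** (covariant twin of ✓ `Prop7FaceFluxLineMean.sq_lineMean_sub_faceMean_le`, constant `1`):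
over a finite family of lines `x_r` (`#r = V`, e.g. the `(L^e)^d` block offsets of `A^V`) with bi-contractive prefixes `g_r` and face indices `t₀ r < ℓ`,
`‖(Vℓ)⁻¹·Σ_rΣ_{t<ℓ} R(g_r·V([x_r, x_r+te_μ]))f(x_r+te_μ) − V⁻¹·Σ_r R(g_r·V([x_r, x_r+(t₀ r)e_μ]))f(x_r+(t₀ r)e_μ)‖² ≤ ℓV⁻¹·Σ_rΣ_{s<ℓ}‖(∇^V_μ f)(x_r+se_μ)‖²`.
No divergence condition and no plaquette variable enter. [cite: Balaban1984PropagatorsI, (1.21) p.21, Prop. 1.1 (1.90) p.33; Balaban1985Variational, Prop. 7 p.299] -/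
theorem normSq_blockLineMean_sub_faceMean_le {V : GaugeField P i (Matrix (Fin N) (Fin N) ℂ)ˣ} (hV : ∀ b, V b ∈ U1 (Matrix (Fin N) (Fin N) ℂ))
    {ι : Type*} (s : Finset ι) {Vv : ℝ} (hVv : 0 < Vv) (hcard : (s.card : ℝ) = Vv) {ℓ : ℕ} (hℓ : 0 < ℓ)
    (g : ι → (Matrix (Fin N) (Fin N) ℂ)ˣ) (hg : ∀ r ∈ s, g r ∈ U1 (Matrix (Fin N) (Fin N) ℂ)) (xr : ι → Site P i) (t₀ : ι → ℕ) (ht₀ : ∀ r ∈ s, t₀ r < ℓ)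
    (f : Site P i → Matrix (Fin N) (Fin N) ℂ) (μ : Fin P.d) :
    ‖(Vv * ℓ)⁻¹ • (∑ r ∈ s, ∑ t ∈ range ℓ, conjR (g r * holT V (xr r) (List.replicate t (μ, true))) (f ((fun z : Site P i => z.shift μ)^[t] (xr r))))
        - Vv⁻¹ • ∑ r ∈ s, conjR (g r * holT V (xr r) (List.replicate (t₀ r) (μ, true))) (f ((fun z : Site P i => z.shift μ)^[t₀ r] (xr r)))‖ ^ 2
      ≤ ℓ * Vv⁻¹ * ∑ r ∈ s, ∑ s' ∈ range ℓ, ‖conjR (V ⟨(fun z : Site P i => z.shift μ)^[s'] (xr r), μ⟩) (f (((fun z : Site P i => z.shift μ)^[s'] (xr r)).shift μ))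
            - f ((fun z : Site P i => z.shift μ)^[s'] (xr r))‖ ^ 2 := by
  have hℓr : (0 : ℝ) < ℓ := by exact_mod_cast hℓ
  -- rewrite `V⁻¹·Σ_r Face_r = (Vℓ)⁻¹·Σ_r ℓ•Face_r`
  set T : Matrix (Fin N) (Fin N) ℂ := ∑ r ∈ s, (∑ t ∈ range ℓ, conjR (g r * holT V (xr r) (List.replicate t (μ, true))) (f ((fun z : Site P i => z.shift μ)^[t] (xr r)))
      - (ℓ : ℝ) • conjR (g r * holT V (xr r) (List.replicate (t₀ r) (μ, true))) (f ((fun z : Site P i => z.shift μ)^[t₀ r] (xr r)))) with hT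
  have hrew : (Vv * ℓ)⁻¹ • (∑ r ∈ s, ∑ t ∈ range ℓ, conjR (g r * holT V (xr r) (List.replicate t (μ, true))) (f ((fun z : Site P i => z.shift μ)^[t] (xr r))))
        - Vv⁻¹ • ∑ r ∈ s, conjR (g r * holT V (xr r) (List.replicate (t₀ r) (μ, true))) (f ((fun z : Site P i => z.shift μ)^[t₀ r] (xr r)))
      = (Vv * ℓ)⁻¹ • T := by
    have hV1 : (Vv * ℓ)⁻¹ * (ℓ : ℝ) = Vv⁻¹ := by field_simp
    rw [hT, Finset.sum_sub_distrib, smul_sub, ← Finset.smul_sum, smul_smul, hV1]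
  rw [hrew]
  set G : ι → ℝ := fun r => ∑ s' ∈ range ℓ, ‖conjR (V ⟨(fun z : Site P i => z.shift μ)^[s'] (xr r), μ⟩) (f (((fun z : Site P i => z.shift μ)^[s'] (xr r)).shift μ))
      - f ((fun z : Site P i => z.shift μ)^[s'] (xr r))‖ with hG
  refine normSq_smul_le_aux s hVv hℓr hcard T G _ ?_ ?_ (fun r _ => Finset.sum_nonneg fun _ _ => norm_nonneg _)
  · rw [hT]
    refine (norm_sum_le _ _).trans (Finset.sum_le_sum fun r hr => ?_)
    exact norm_lineSum_sub_smul_faceValue_le hV (hg r hr) f (xr r) μ (ht₀ r hr)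
  · intro r _
    -- `(Σ_{s<ℓ} u_s)² ≤ ℓ·Σ u_s²`
    have hcs := sq_sum_le_card_mul_sum_sq (s := range ℓ)
      (f := fun s' => ‖conjR (V ⟨(fun z : Site P i => z.shift μ)^[s'] (xr r), μ⟩) (f (((fun z : Site P i => z.shift μ)^[s'] (xr r)).shift μ))
        - f ((fun z : Site P i => z.shift μ)^[s'] (xr r))‖)
    rw [card_range] at hcs
    simpa only [hG] using hcs

/-! ## §3 The 1-D trace inequality along a covariant line -/

/-- ★ **THE 1-D TRACE INEQUALITY ALONG A COVARIANT LINE**: for `t₀ < n`, `‖f(x+t₀e_μ)‖² ≤ 2n⁻¹·Σ_{s<n}‖f(x+se_μ)‖² + 2n·Σ_{s<n}‖(∇^V_μ f)(x+se_μ)‖²` — by §1 with `g = 1`,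
`‖f(x_{t₀})‖ ≤ ‖f(x_s)‖ + Σ_j‖∇^V_μ f(x_j)‖` for every `s < n` (transports are isometries and invisible in norms); average over `s`, square, Cauchy–Schwarz.
Summed over the lines of a block it books every face-supported mass by `2ℓ⁻¹·(block mass) + 2ℓ·(longitudinal covariant gradient energy)`.
[cite: Balaban1984PropagatorsI, (1.21) p.21; Balaban1985RegularSpaces, (1.1) p.76] -/
theorem normSq_apply_le_line_trace {V : GaugeField P i (Matrix (Fin N) (Fin N) ℂ)ˣ} (hV : ∀ b, V b ∈ U1 (Matrix (Fin N) (Fin N) ℂ))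
    (f : Site P i → Matrix (Fin N) (Fin N) ℂ) (x : Site P i) (μ : Fin P.d) {t₀ n : ℕ} (ht₀ : t₀ < n) :
    ‖f ((fun z : Site P i => z.shift μ)^[t₀] x)‖ ^ 2
      ≤ 2 * (n : ℝ)⁻¹ * ∑ s ∈ range n, ‖f ((fun z : Site P i => z.shift μ)^[s] x)‖ ^ 2
        + 2 * (n : ℝ) * ∑ s ∈ range n, ‖conjR (V ⟨(fun z : Site P i => z.shift μ)^[s] x, μ⟩) (f (((fun z : Site P i => z.shift μ)^[s] x).shift μ))
            - f ((fun z : Site P i => z.shift μ)^[s] x)‖ ^ 2 := by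
  have hn : 0 < n := lt_of_le_of_lt (Nat.zero_le _) ht₀
  have hnr : (0 : ℝ) < n := by exact_mod_cast hn
  have h1 : (1 : (Matrix (Fin N) (Fin N) ℂ)ˣ) ∈ U1 (Matrix (Fin N) (Fin N) ℂ) := one_mem _
  set D : ℝ := ∑ s ∈ range n, ‖conjR (V ⟨(fun z : Site P i => z.shift μ)^[s] x, μ⟩) (f (((fun z : Site P i => z.shift μ)^[s] x).shift μ))
      - f ((fun z : Site P i => z.shift μ)^[s] x)‖ with hD
  set m : ℕ → ℝ := fun s => ‖f ((fun z : Site P i => z.shift μ)^[s] x)‖ with hm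
  -- pointwise: `m t₀ ≤ m s + D` for every `s < n`
  have hpt : ∀ s ∈ range n, m t₀ ≤ m s + D := by
    intro s hs
    have h := norm_conjR_line_sub_conjR_line_le hV h1 f x μ ht₀.le (mem_range.1 hs).le
    rw [one_mul, one_mul] at h
    -- `‖A‖ ≤ ‖B‖ + ‖A − B‖` after undoing the isometries
    have hA : m t₀ = ‖conjR (holT V x (List.replicate t₀ (μ, true))) (f ((fun z : Site P i => z.shift μ)^[t₀] x))‖ := by
      rw [hm]; exact (norm_conjR (holT_mem hV x _) _).symm
    have hB : m s = ‖conjR (holT V x (List.replicate s (μ, true))) (f ((fun z : Site P i => z.shift μ)^[s] x))‖ := by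
      rw [hm]; exact (norm_conjR (holT_mem hV x _) _).symm
    rw [hA, hB]
    exact (norm_le_norm_add_norm_sub' _ _).trans (by linarith [h])
  -- average over `s < n`: `n·m t₀ ≤ Σ m s + n·D`
  have havg : (n : ℝ) * m t₀ ≤ ∑ s ∈ range n, m s + (n : ℝ) * D := by
    have := Finset.sum_le_sum hpt
    rw [Finset.sum_const, card_range, nsmul_eq_mul, Finset.sum_add_distrib, Finset.sum_const, card_range, nsmul_eq_mul] at this
    exact this
  -- Cauchy–Schwarz: `(Σ m s)² ≤ n·Σ m s²`, `D² ≤ n·Σ(…)²`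
  have hcs1 : (∑ s ∈ range n, m s) ^ 2 ≤ (n : ℝ) * ∑ s ∈ range n, m s ^ 2 := by
    have hcs := sq_sum_le_card_mul_sum_sq (s := range n) (f := m)
    rwa [card_range] at hcs
  have hcs2 : D ^ 2 ≤ (n : ℝ) * ∑ s ∈ range n, ‖conjR (V ⟨(fun z : Site P i => z.shift μ)^[s] x, μ⟩) (f (((fun z : Site P i => z.shift μ)^[s] x).shift μ))
      - f ((fun z : Site P i => z.shift μ)^[s] x)‖ ^ 2 := by
    have hcs := sq_sum_le_card_mul_sum_sq (s := range n)
      (f := fun s => ‖conjR (V ⟨(fun z : Site P i => z.shift μ)^[s] x, μ⟩) (f (((fun z : Site P i => z.shift μ)^[s] x).shift μ))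
        - f ((fun z : Site P i => z.shift μ)^[s] x)‖)
    rw [card_range] at hcs
    simpa only [hD] using hcs
  have hm0 : 0 ≤ m t₀ := norm_nonneg _
  have hD0 : 0 ≤ D := Finset.sum_nonneg fun _ _ => norm_nonneg _
  have hS0 : 0 ≤ ∑ s ∈ range n, m s := Finset.sum_nonneg fun _ _ => norm_nonneg _
  -- `m t₀ ≤ n⁻¹Σ m + D` ⇒ `m t₀² ≤ 2 n⁻²(Σ m)² + 2D² ≤ 2n⁻¹Σ m² + 2n Σ(…)²`
  set S : ℝ := ∑ s ∈ range n, m s with hS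
  have hdiv : m t₀ ≤ (n : ℝ)⁻¹ * S + D := by
    have e1 : m t₀ = (n : ℝ)⁻¹ * ((n : ℝ) * m t₀) := by field_simp
    have e2 : (n : ℝ)⁻¹ * (S + (n : ℝ) * D) = (n : ℝ)⁻¹ * S + D := by field_simp
    rw [e1, ← e2]
    exact mul_le_mul_of_nonneg_left havg (inv_nonneg.2 hnr.le)
  have hA0 : 0 ≤ (n : ℝ)⁻¹ * S := mul_nonneg (inv_nonneg.2 hnr.le) hS0
  have hsq : m t₀ ^ 2 ≤ 2 * ((n : ℝ)⁻¹ * S) ^ 2 + 2 * D ^ 2 := by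
    have h1 : m t₀ ^ 2 ≤ ((n : ℝ)⁻¹ * S + D) ^ 2 := pow_le_pow_left₀ hm0 hdiv 2
    nlinarith [h1, sq_nonneg ((n : ℝ)⁻¹ * S - D)]
  have hA : 2 * ((n : ℝ)⁻¹ * S) ^ 2 ≤ 2 * (n : ℝ)⁻¹ * ∑ s ∈ range n, m s ^ 2 := by
    have e : 2 * ((n : ℝ)⁻¹ * S) ^ 2 = 2 * (n : ℝ)⁻¹ * ((n : ℝ)⁻¹ * S ^ 2) := by ring
    rw [e]
    refine mul_le_mul_of_nonneg_left ?_ (by positivity)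
    rw [inv_mul_le_iff₀ hnr]
    exact hcs1
  have hB : 2 * D ^ 2 ≤ 2 * (n : ℝ) * ∑ s ∈ range n, ‖conjR (V ⟨(fun z : Site P i => z.shift μ)^[s] x, μ⟩) (f (((fun z : Site P i => z.shift μ)^[s] x).shift μ))
      - f ((fun z : Site P i => z.shift μ)^[s] x)‖ ^ 2 := by
    rw [mul_assoc]
    exact mul_le_mul_of_nonneg_left hcs2 (by norm_num)
  have hgoal : m t₀ ^ 2 ≤ 2 * (n : ℝ)⁻¹ * ∑ s ∈ range n, m s ^ 2
      + 2 * (n : ℝ) * ∑ s ∈ range n, ‖conjR (V ⟨(fun z : Site P i => z.shift μ)^[s] x, μ⟩) (f (((fun z : Site P i => z.shift μ)^[s] x).shift μ))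
            - f ((fun z : Site P i => z.shift μ)^[s] x)‖ ^ 2 := by linarith [hsq, hA, hB]
  simpa only [hm] using hgoal

end Summit.QuantumFields.YangMills.Theorems.Prop7CovLineFaceTrace

end
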